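import Mathlib.LinearAlgebra.Matrix.Permutation
import Mathlib.Analysis.SpecialFunctions.Complex.Circle
import Literature.LinearAlgebra.Matrix.UnitaryDiagonalization
import Literature.LinearAlgebra.Matrix.DiagonalTorusGL
import Literature.NumberTheory.Automorphic.UnitaryGroupFormTransport
import HarnessLib

/-!
# Homomorphisms from a definite unitary group over `ℂ` to an abelian group kill `SU`

Topic `LinearAlgebra/Matrix`; namespace `Literature.LinearAlgebra.Matrix.UnitaryHomDet`.  KERNEL only (theorems,
no definition, no notation, no named fact, no `sorry`).

For the standard unitary group `U(n) = unitaryGroupOfForm (starRingEnd ℂ) 1 = {g ∈ GLₙ(ℂ) ∣ gᴴ g = 1}` (the tree's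
`unitaryGroupOfForm`, `UnitaryGroupAutomorphicRep` / `UnitaryGroupFormTransport`) and ANY homomorphism `θ : U(n) →* A`
to a commutative group:

* `apply_eq_one_of_val_eq_diagonal` — `θ` kills the diagonal torus elements of determinant `1` (commutators with
  permutation matrices);
* **`apply_eq_one_of_det_eq_one_one`** — `θ g = 1` whenever `det g = 1`: `SU(N) ≤ ker θ` (via the tree's unitary
  spectral theorem `Literature.LinearAlgebra.Matrix.exists_unitary_diagonalization` [HornJohnson2013, Thm. 2.5.3];
  classically `SU(N)` is the commutator subgroup of `U(N)`, [Dieudonne1971GroupesClassiques, Chap. II §5]);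
* **`apply_eq_one_of_det_eq_one_diagonal_pos`** / `…_neg` — the same for the unitary group of a DEFINITE diagonal
  form `diag(r₁, …, rₙ)`, `rᵢ > 0` (resp. `< 0`), by transport along `diag(√rᵢ)` (`conj_mem_unitaryGroupOfForm_iff`).

Consumed at the DEFINITE complex places by the adelic factorisation of characters of `U(J)(𝔸)` through `det`
(`NumberTheory/Automorphic/UnitaryGroupAdelicCharactersDet`).

## References

* J. Dieudonné, *La géométrie des groupes classiques*, 3e éd., Springer (1971), Chap. II §5
  [Dieudonne1971GroupesClassiques].
-/

set_option autoImplicit false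

open Matrix

namespace Literature.LinearAlgebra.Matrix

namespace UnitaryHomDet

open Literature.NumberTheory.Automorphic

variable {n : Type*} [Fintype n] [DecidableEq n] {A : Type*} [CommGroup A]

/-! ## §1 Transport of `SU ≤ ker θ` along a change of basis -/

/-- If `σ(T)ᵀ H T = H'` and `SU(H') ≤ ker θ'` for every `θ'`, then `SU(H) ≤ ker θ` for every `θ`
(conjugation by `T`). [cite: PlatonovRapinchuk1994, §2.3] -/
private theorem apply_eq_one_of_det_eq_one_of_formCongr {K : Type*} [Field K] {σ : K →+* K} (T : GL n K)
    (H H' : Matrix n n K) (hT : formCongr σ T H = H')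
    (hH' : ∀ (θ' : ↥(unitaryGroupOfForm σ H') →* A) (g' : ↥(unitaryGroupOfForm σ H')), g'.1.1.det = 1 → θ' g' = 1)
    (θ : ↥(unitaryGroupOfForm σ H) →* A) (g : ↥(unitaryGroupOfForm σ H)) (hdet : g.1.1.det = 1) : θ g = 1 := by
  subst hT
  let ψ : ↥(unitaryGroupOfForm σ (formCongr σ T H)) →* ↥(unitaryGroupOfForm σ H) :=
    (((MulAut.conj T).toMonoidHom.restrict (unitaryGroupOfForm σ (formCongr σ T H))).codRestrict
      (unitaryGroupOfForm σ H) (fun g' => conj_mem_unitaryGroupOfForm σ T H g'.2))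
  have hg' : T⁻¹ * g.1 * T ∈ unitaryGroupOfForm σ (formCongr σ T H) := by
    rw [← conj_mem_unitaryGroupOfForm_iff]
    simpa only [mul_assoc, mul_inv_cancel, mul_one, mul_inv_cancel_left] using g.2
  have hψ : ψ ⟨T⁻¹ * g.1 * T, hg'⟩ = g := by
    apply Subtype.ext
    show T * (T⁻¹ * g.1 * T) * T⁻¹ = g.1
    group
  have hdet' : (⟨T⁻¹ * g.1 * T, hg'⟩ : ↥(unitaryGroupOfForm σ (formCongr σ T H))).1.1.det = 1 := by
    show ((T⁻¹ * g.1 * T : GL n K) : Matrix n n K).det = 1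
    rw [Units.val_mul, Units.val_mul, Matrix.det_mul, Matrix.det_mul, hdet, mul_one, ← Matrix.det_mul,
      ← Units.val_mul, inv_mul_cancel, Units.val_one, Matrix.det_one]
  rw [← hψ]
  exact hH' (θ.comp ψ) _ hdet'

/-! ## §2 The diagonal torus `(U(1))ⁿ → U(n)` and the permutation matrices -/

/-- A diagonal matrix with unitary entries is unitary for the standard form. [folklore] -/
private theorem diagGL_mem (u : n → unitary ℂ) :
    DiagonalTorus.diagGL n (fun i => Unitary.toUnits (u i)) ∈ unitaryGroupOfForm (starRingEnd ℂ) (1 : Matrix n n ℂ) := by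
  rw [mem_unitaryGroupOfForm_iff, Matrix.mul_one, DiagonalTorus.val_diagGL, Matrix.diagonal_map (map_zero _),
    Matrix.diagonal_transpose, Matrix.diagonal_mul_diagonal, ← Matrix.diagonal_one]
  congr 1
  funext i
  exact (u i).2.1

/-- The torus embedding `ι : (U(1))ⁿ →* U(n)`, `u ↦ diag(u)`, realised without a definition: existence of an
element of `U(n)` with matrix `diag(u)` depending multiplicatively on `u`. We package it as the composite
homomorphism below. [folklore] -/
private theorem exists_torusHom :
    ∃ ι : (n → unitary ℂ) →* ↥(unitaryGroupOfForm (starRingEnd ℂ) (1 : Matrix n n ℂ)),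
      ∀ u, (ι u).1 = DiagonalTorus.diagGL n (fun i => Unitary.toUnits (u i)) :=
  ⟨(((DiagonalTorus.diagGL n).comp (MonoidHom.compLeft (Unitary.toUnits (R := ℂ)) n)).codRestrict
      (unitaryGroupOfForm (starRingEnd ℂ) (1 : Matrix n n ℂ)) (fun u => diagGL_mem u)), fun _ => rfl⟩

/-- A permutation matrix is unitary for the standard form. [folklore] -/
private theorem perm_mem (τ : Equiv.Perm n) :
    (⟨τ.permMatrix ℂ, τ⁻¹.permMatrix ℂ, by rw [← Matrix.permMatrix_mul, inv_mul_cancel, Matrix.permMatrix_one],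
      by rw [← Matrix.permMatrix_mul, mul_inv_cancel, Matrix.permMatrix_one]⟩ : GL n ℂ) ∈
      unitaryGroupOfForm (starRingEnd ℂ) (1 : Matrix n n ℂ) := by
  rw [mem_unitaryGroupOfForm_iff, Matrix.mul_one]
  show ((τ.permMatrix ℂ).map (starRingEnd ℂ))ᵀ * τ.permMatrix ℂ = 1
  have hmap : (τ.permMatrix ℂ).map (starRingEnd ℂ) = τ.permMatrix ℂ := by
    ext i j
    simp [Equiv.Perm.permMatrix, PEquiv.toMatrix_apply, apply_ite (starRingEnd ℂ)]
  rw [hmap, Matrix.transpose_permMatrix, ← Matrix.permMatrix_mul, mul_inv_cancel, Matrix.permMatrix_one]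

omit [Fintype n] in
/-- `mulSingle i x ∘ swap i j = mulSingle j x`. [folklore] -/
private theorem mulSingle_comp_swap (i j : n) (x : unitary ℂ) :
    (Pi.mulSingle i x : n → unitary ℂ) ∘ (Equiv.swap i j) = Pi.mulSingle j x := by
  funext k
  simp only [Function.comp_apply]
  by_cases hk : k = j
  · subst hk
    rw [Equiv.swap_apply_right, Pi.mulSingle_eq_same, Pi.mulSingle_eq_same]
  · by_cases hki : k = i
    · subst hki
      rw [Equiv.swap_apply_left, Pi.mulSingle_eq_of_ne hk, Pi.mulSingle_eq_of_ne (Ne.symm hk)]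
    · rw [Equiv.swap_apply_of_ne_of_ne hki hk, Pi.mulSingle_eq_of_ne hki, Pi.mulSingle_eq_of_ne hk]

/-- On the torus `θ ∘ ι` is invariant under permuting the coordinates (conjugation by a permutation matrix inside
`U(n)`). [folklore] -/
private theorem apply_torus_comp_perm (θ : ↥(unitaryGroupOfForm (starRingEnd ℂ) (1 : Matrix n n ℂ)) →* A)
    (ι : (n → unitary ℂ) →* ↥(unitaryGroupOfForm (starRingEnd ℂ) (1 : Matrix n n ℂ)))
    (hι : ∀ u, (ι u).1 = DiagonalTorus.diagGL n (fun i => Unitary.toUnits (u i))) (τ : Equiv.Perm n)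
    (u : n → unitary ℂ) : θ (ι (u ∘ τ)) = θ (ι u) := by
  let p : ↥(unitaryGroupOfForm (starRingEnd ℂ) (1 : Matrix n n ℂ)) := ⟨_, perm_mem τ⟩
  have key : p * ι u * p⁻¹ = ι (u ∘ τ) := by
    apply Subtype.ext
    rw [Subgroup.coe_mul, Subgroup.coe_mul, Subgroup.coe_inv, hι, hι]
    apply Units.ext
    show τ.permMatrix ℂ * Matrix.diagonal (fun k => ((Unitary.toUnits (u k) : ℂˣ) : ℂ)) * τ⁻¹.permMatrix ℂ =
      Matrix.diagonal _
    rw [Equiv.Perm.permMatrix, Equiv.Perm.permMatrix, PEquiv.toMatrix_toPEquiv_mul, PEquiv.mul_toMatrix_toPEquiv]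
    show (Matrix.diagonal fun k => ((Unitary.toUnits (u k) : ℂˣ) : ℂ)).submatrix τ τ = _
    rw [Matrix.submatrix_diagonal_equiv]
    rfl
  rw [← key, map_mul, map_mul, map_inv, mul_right_comm, mul_inv_cancel, one_mul]

/-- **On the torus `θ ∘ ι` depends only on the product of the entries.** [folklore] -/
private theorem apply_torus_eq (θ : ↥(unitaryGroupOfForm (starRingEnd ℂ) (1 : Matrix n n ℂ)) →* A)
    (ι : (n → unitary ℂ) →* ↥(unitaryGroupOfForm (starRingEnd ℂ) (1 : Matrix n n ℂ)))
    (hι : ∀ u, (ι u).1 = DiagonalTorus.diagGL n (fun i => Unitary.toUnits (u i))) (i₀ : n)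
    (u : n → unitary ℂ) : θ (ι u) = θ (ι (Pi.mulSingle i₀ (∏ i, u i))) := by
  set φ : (n → unitary ℂ) →* A := θ.comp ι with hφ
  have hu : (∏ i, Pi.mulSingle i (u i) : n → unitary ℂ) = u := Finset.univ_prod_mulSingle u
  have h1 : ∀ i, φ (Pi.mulSingle i (u i)) = φ (Pi.mulSingle i₀ (u i)) := fun i => by
    simp only [hφ, MonoidHom.comp_apply]
    rw [← mulSingle_comp_swap i i₀ (u i), apply_torus_comp_perm θ ι hι]
  have h2 : (∏ i, Pi.mulSingle i₀ (u i) : n → unitary ℂ) = Pi.mulSingle i₀ (∏ i, u i) := by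
    have := (map_prod (MonoidHom.mulSingle (fun _ : n => unitary ℂ) i₀) u Finset.univ).symm
    simpa only [MonoidHom.mulSingle_apply] using this
  calc θ (ι u) = φ u := rfl
    _ = ∏ i, φ (Pi.mulSingle i (u i)) := by rw [← map_prod, hu]
    _ = ∏ i, φ (Pi.mulSingle i₀ (u i)) := Finset.prod_congr rfl fun i _ => h1 i
    _ = φ (∏ i, Pi.mulSingle i₀ (u i)) := (map_prod φ _ _).symm
    _ = φ (Pi.mulSingle i₀ (∏ i, u i)) := by rw [h2]
    _ = θ (ι (Pi.mulSingle i₀ (∏ i, u i))) := rfl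

/-- **`θ` kills the diagonal elements of `U(n)` of determinant one**: if `g ∈ U(n)` has matrix `diag(d)` with
`∏ dᵢ = 1` then `θ g = 1`. [cite: Dieudonne1971GroupesClassiques, Chap. II §5] -/
theorem apply_eq_one_of_val_eq_diagonal (θ : ↥(unitaryGroupOfForm (starRingEnd ℂ) (1 : Matrix n n ℂ)) →* A)
    (g : ↥(unitaryGroupOfForm (starRingEnd ℂ) (1 : Matrix n n ℂ))) (d : n → ℂ)
    (hd : ∀ i, (starRingEnd ℂ) (d i) * d i = 1) (hg : g.1.1 = Matrix.diagonal d) (hprod : ∏ i, d i = 1) :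
    θ g = 1 := by
  rcases isEmpty_or_nonempty n with hn | ⟨⟨i₀⟩⟩
  · have : g = 1 := Subtype.ext (Units.ext (Matrix.ext fun i _ => (IsEmpty.false i).elim))
    rw [this, map_one]
  obtain ⟨ι, hι⟩ := exists_torusHom (n := n)
  have hd' : ∀ i, d i ∈ unitary ℂ := fun i =>
    ⟨hd i, by rw [mul_comm]; exact hd i⟩
  set u : n → unitary ℂ := fun i => ⟨d i, hd' i⟩ with hu
  have hgu : g = ι u := by
    apply Subtype.ext; apply Units.ext
    rw [hg, hι, DiagonalTorus.val_diagGL]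
    rfl
  have hprod' : (∏ i, u i) = 1 := by
    apply Subtype.ext
    rw [Submonoid.coe_finsetProd]
    exact hprod
  rw [hgu, apply_torus_eq θ ι hι i₀ u, hprod', Pi.mulSingle_one, map_one, map_one]

/-! ## §3 `SU(N) ≤ ker θ`; definite diagonal forms -/

/-- **Every homomorphism from the unitary group `U(n) = {g ∣ gᴴ g = 1}` to a commutative group kills `SU(n)`**:
`θ g = 1` whenever `det g = 1` (unitary diagonalisation + the torus). [cite: Dieudonne1971GroupesClassiques, Chap. II §5] -/
theorem apply_eq_one_of_det_eq_one_one {N : ℕ}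
    (θ : ↥(unitaryGroupOfForm (starRingEnd ℂ) (1 : Matrix (Fin N) (Fin N) ℂ)) →* A)
    (g : ↥(unitaryGroupOfForm (starRingEnd ℂ) (1 : Matrix (Fin N) (Fin N) ℂ))) (hdet : g.1.1.det = 1) : θ g = 1 := by
  have hg : g.1.1ᴴ * g.1.1 = 1 := by
    have := (mem_unitaryGroupOfForm_star_iff_conjTranspose (1 : Matrix (Fin N) (Fin N) ℂ) g.1).1 g.2
    rwa [Matrix.mul_one] at this
  obtain ⟨U, ang, hU, hgd⟩ := exists_unitary_diagonalization g.1.1 hg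
  set d : Fin N → ℂ := fun a => Complex.exp (ang a * Complex.I) with hd_def
  have hd : ∀ i, (starRingEnd ℂ) (d i) * d i = 1 := by
    intro i
    rw [hd_def, Complex.conj_mul', Complex.norm_exp_ofReal_mul_I]
    simp
  have hU' : U * Uᴴ = 1 := mul_eq_one_comm.1 hU
  let Ug : GL (Fin N) ℂ := ⟨U, Uᴴ, hU', hU⟩
  have hUmem : Ug ∈ unitaryGroupOfForm (starRingEnd ℂ) (1 : Matrix (Fin N) (Fin N) ℂ) := by
    rw [mem_unitaryGroupOfForm_star_iff_conjTranspose, Matrix.mul_one]; exact hU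
  let u : Fin N → unitary ℂ := fun i => ⟨d i, hd i, by rw [mul_comm]; exact hd i⟩
  obtain ⟨ι, hι⟩ := exists_torusHom (n := Fin N)
  have hιu : (ι u).1.1 = Matrix.diagonal d := by rw [hι, DiagonalTorus.val_diagGL]; rfl
  have hgeq : g = ⟨Ug, hUmem⟩ * ι u * ⟨Ug, hUmem⟩⁻¹ := by
    apply Subtype.ext; apply Units.ext
    show g.1.1 = U * (ι u).1.1 * Uᴴ
    rw [hιu, hgd]
  have hprod : ∏ i, d i = 1 := by
    have h1 := congrArg Matrix.det hgd
    rw [hdet, Matrix.det_mul, Matrix.det_mul, Matrix.det_diagonal] at h1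
    have hUU : U.det * Uᴴ.det = 1 := by rw [← Matrix.det_mul, hU', Matrix.det_one]
    calc ∏ i, d i = (U.det * Uᴴ.det) * ∏ i, d i := by rw [hUU, one_mul]
      _ = 1 := by rw [h1]; ring
  rw [hgeq, map_mul, map_mul, map_inv, mul_right_comm, mul_inv_cancel, one_mul]
  exact apply_eq_one_of_val_eq_diagonal θ (ι u) d hd hιu hprod

/-- `U(σ, -H) = U(σ, H)`. [folklore] -/
private theorem unitaryGroupOfForm_neg {K : Type*} [CommRing K] (σ : K →+* K) (H : Matrix n n K) :
    unitaryGroupOfForm σ (-H) = unitaryGroupOfForm σ H := by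
  ext g
  rw [mem_unitaryGroupOfForm_iff, mem_unitaryGroupOfForm_iff, Matrix.mul_neg, Matrix.neg_mul, neg_inj]

/-- `SU ≤ ker θ` for the form `-1` (same group as for `1`). [cite: Dieudonne1971GroupesClassiques, Chap. II §5] -/
theorem apply_eq_one_of_det_eq_one_neg_one {N : ℕ}
    (θ : ↥(unitaryGroupOfForm (starRingEnd ℂ) (-1 : Matrix (Fin N) (Fin N) ℂ)) →* A)
    (g : ↥(unitaryGroupOfForm (starRingEnd ℂ) (-1 : Matrix (Fin N) (Fin N) ℂ))) (hdet : g.1.1.det = 1) :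
    θ g = 1 := by
  have e := unitaryGroupOfForm_neg (starRingEnd ℂ) (1 : Matrix (Fin N) (Fin N) ℂ)
  have := apply_eq_one_of_det_eq_one_one (θ.comp (MulEquiv.subgroupCongr e).symm.toMonoidHom)
    (MulEquiv.subgroupCongr e g) hdet
  simpa using this

/-- the rescaling `diag(√|rᵢ|)⁻¹` turns a definite diagonal form into `± 1`: entry computation. [folklore] -/
private theorem sqrt_inv_mul_mul_sqrt_inv (r : ℝ) (hr : 0 < r) :
    (starRingEnd ℂ) (((Real.sqrt r)⁻¹ : ℝ) : ℂ) * (r : ℂ) * (((Real.sqrt r)⁻¹ : ℝ) : ℂ) = 1 := by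
  rw [Complex.conj_ofReal]
  have hs : Real.sqrt r ≠ 0 := (Real.sqrt_pos.2 hr).ne'
  have h : ((Real.sqrt r)⁻¹ : ℝ) * r * (Real.sqrt r)⁻¹ = 1 := by
    field_simp
    rw [Real.sq_sqrt hr.le]
  exact_mod_cast h

/-- **`SU ≤ ker θ` for a POSITIVE definite diagonal form** `diag(r)`, `rᵢ > 0` (transport to the standard form
along `diag(√rᵢ)⁻¹`). [cite: Dieudonne1971GroupesClassiques, Chap. II §5] -/
theorem apply_eq_one_of_det_eq_one_diagonal_pos {N : ℕ} (r : Fin N → ℝ) (hr : ∀ i, 0 < r i)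
    (θ : ↥(unitaryGroupOfForm (starRingEnd ℂ) (Matrix.diagonal fun i => ((r i : ℝ) : ℂ))) →* A)
    (g : ↥(unitaryGroupOfForm (starRingEnd ℂ) (Matrix.diagonal fun i => ((r i : ℝ) : ℂ))))
    (hdet : g.1.1.det = 1) : θ g = 1 := by
  have ht0 : ∀ i, (((Real.sqrt (r i))⁻¹ : ℝ) : ℂ) ≠ 0 := fun i => by
    exact_mod_cast inv_ne_zero (Real.sqrt_pos.2 (hr i)).ne'
  let T : GL (Fin N) ℂ := DiagonalTorus.diagGL (Fin N) fun i => Units.mk0 _ (ht0 i)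
  have hT : formCongr (starRingEnd ℂ) T (Matrix.diagonal fun i => ((r i : ℝ) : ℂ)) = 1 := by
    rw [formCongr, DiagonalTorus.val_diagGL, Matrix.diagonal_map (map_zero _), Matrix.diagonal_transpose,
      Matrix.diagonal_mul_diagonal, Matrix.diagonal_mul_diagonal, ← Matrix.diagonal_one]
    congr 1
    funext i
    exact sqrt_inv_mul_mul_sqrt_inv (r i) (hr i)
  exact apply_eq_one_of_det_eq_one_of_formCongr T _ _ hT
    (fun θ' g' h' => apply_eq_one_of_det_eq_one_one θ' g' h') θ g hdet

/-- **`SU ≤ ker θ` for a NEGATIVE definite diagonal form** `diag(r)`, `rᵢ < 0`.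
[cite: Dieudonne1971GroupesClassiques, Chap. II §5] -/
theorem apply_eq_one_of_det_eq_one_diagonal_neg {N : ℕ} (r : Fin N → ℝ) (hr : ∀ i, r i < 0)
    (θ : ↥(unitaryGroupOfForm (starRingEnd ℂ) (Matrix.diagonal fun i => ((r i : ℝ) : ℂ))) →* A)
    (g : ↥(unitaryGroupOfForm (starRingEnd ℂ) (Matrix.diagonal fun i => ((r i : ℝ) : ℂ))))
    (hdet : g.1.1.det = 1) : θ g = 1 := by
  have hr' : ∀ i, 0 < -r i := fun i => neg_pos.2 (hr i)
  have ht0 : ∀ i, (((Real.sqrt (-r i))⁻¹ : ℝ) : ℂ) ≠ 0 := fun i => by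
    exact_mod_cast inv_ne_zero (Real.sqrt_pos.2 (hr' i)).ne'
  let T : GL (Fin N) ℂ := DiagonalTorus.diagGL (Fin N) fun i => Units.mk0 _ (ht0 i)
  have hT : formCongr (starRingEnd ℂ) T (Matrix.diagonal fun i => ((r i : ℝ) : ℂ)) = -1 := by
    rw [formCongr, DiagonalTorus.val_diagGL, Matrix.diagonal_map (map_zero _), Matrix.diagonal_transpose,
      Matrix.diagonal_mul_diagonal, Matrix.diagonal_mul_diagonal, ← Matrix.diagonal_one, Matrix.diagonal_neg]
    congr 1
    funext i
    have := sqrt_inv_mul_mul_sqrt_inv (-r i) (hr' i)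
    rw [Complex.ofReal_neg, mul_neg, neg_mul, neg_eq_iff_eq_neg] at this
    exact this
  exact apply_eq_one_of_det_eq_one_of_formCongr T _ _ hT
    (fun θ' g' h' => apply_eq_one_of_det_eq_one_neg_one θ' g' h') θ g hdet

end UnitaryHomDet

end Literature.LinearAlgebra.Matrix
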